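import Summits.Ventures.DiscreteObjects.Hadamard.ConferenceGraph333LargePrimeProducts
import Summits.Ventures.DiscreteObjects.Hadamard.ConferenceGraph333Order13

/-!
# Large primes in Aut(srg(333,166,82,83)): 37 ∣ orderOf σ ⇒ orderOf σ ∈ {37, 74, 148}; 41 ∣ orderOf σ ⇒ {41, 82};
# 83 ∣ orderOf σ ⇒ {83, 166} (kernel)

Framing: lottery ticket; floor = certified bounds/negative ranges.  Cell pub-namedobj (venture DiscreteObjects),
target (H) = `H(668)`, hadamard gen 30.  Assembly of `ConferenceGraph333LargePrimeProducts` (no element of order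
`5·41, 7·41, 11·41, 7·37, 11·37, 5·83, 7·83, 11·83, 37·41, 37·83, 41·83, 4·83, 8·37`) with the earlier census
(gen 29: `111, 123, 164, 185, 249 ∤ orderOf σ`; gen 30: prime spectrum `{2,3,5,7,11,37,41,83}` (`Order13`), `37², 41², 83² ∤ orderOf σ` by the
prime-power orbit bound — re-derived here privately so as not to depend on `OrderSummaryG30`):
* **`aut_orderOf_of_83_dvd`** — `83 ∣ orderOf σ ⇒ orderOf σ = 83 ∨ orderOf σ = 166`;
* **`aut_orderOf_of_41_dvd`** — `41 ∣ orderOf σ ⇒ orderOf σ = 41 ∨ orderOf σ = 82`;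
* **`aut_orderOf_of_37_dvd`** — `37 ∣ orderOf σ ⇒ orderOf σ ∈ {37, 74, 148}`.
(Prime by prime through `Nat.dvd_iff_prime_pow_dvd_dvd`; the surviving orders `74, 82, 148, 166` have admissible cycle types at
script level, `166` being the bicirculant family of `ConferenceGraph333Order166`.)  WORDS: structure of a HYPOTHETICAL object;
ours (PROVISIONAL).  No `sorry`, no new definitions.
-/

namespace Summit.Ventures.DiscreteObjects.Hadamard

open Finset

section largeprimes2
variable {V : Type*} [Fintype V] [DecidableEq V]

/-- prime divisors of `orderOf σ` (private copy of `ConferenceGraph333OrderSummaryG30.aut_prime_dvd_orderOf_g30`, to keep this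
file independent of that module). -/
private theorem prime_dvd_orderOf_g30' (hV : Fintype.card V = 333) (A : Matrix V V ℤ)
    (h01 : ∀ x y, A x y = 0 ∨ A x y = 1) (hsymm : ∀ x y, A y x = A x y) (hdiag : ∀ x, A x x = 0)
    (hk : ∀ x, ∑ y, A x y = 166) (hsrg : ∀ x y, ∑ z, A x z * A z y = 83 * (1 + (if x = y then 1 else 0)) - A x y)
    (σ : Equiv.Perm V) (hA : ∀ x y, A (σ x) (σ y) = A x y) {p : ℕ} (hp : p.Prime) (hdvd : p ∣ orderOf σ) :
    p = 2 ∨ p = 3 ∨ p = 5 ∨ p = 7 ∨ p = 11 ∨ p = 37 ∨ p = 41 ∨ p = 83 := by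
  have hAk := adj_pow_invariant A σ hA
  obtain ⟨h1, hne⟩ := pow_orderOf_div_facts σ hdvd
  have hne1 : σ ^ (orderOf σ / p) ≠ 1 := by
    have := hne 1 one_pos hp.one_lt
    rwa [pow_one] at this
  exact aut_prime_spectrum_g30 hV A h01 hsymm hdiag hk hsrg hp _ h1 hne1 (hAk _)

/-- `p² ∤ orderOf σ` for `p ∈ {37, 41, 83}` (private copy of the gen-30 summary facts; prime-power orbit bound). -/
private theorem sq_not_dvd_orderOf' (hV : Fintype.card V = 333) (A : Matrix V V ℤ)
    (h01 : ∀ x y, A x y = 0 ∨ A x y = 1) (hsymm : ∀ x y, A y x = A x y) (hdiag : ∀ x, A x x = 0)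
    (hk : ∀ x, ∑ y, A x y = 166) (hsrg : ∀ x y, ∑ z, A x z * A z y = 83 * (1 + (if x = y then 1 else 0)) - A x y)
    (σ : Equiv.Perm V) (hA : ∀ x y, A (σ x) (σ y) = A x y) {p : ℕ} (hp : p = 37 ∨ p = 41 ∨ p = 83) :
    ¬ p ^ 2 ∣ orderOf σ := by
  intro hdvd
  have hAk := adj_pow_invariant A σ hA
  obtain ⟨h1, hne⟩ := pow_orderOf_div_facts σ hdvd
  rcases hp with rfl | rfl | rfl
  · have hb := aut_prime_pow_order_bound hV A h01 hsymm hdiag hk hsrg (σ ^ (orderOf σ / 37 ^ 2)) (hAk _)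
      (by norm_num : Nat.Prime 37) 1 (by simpa using h1) (by simpa using hne 37 (by norm_num) (by norm_num))
    have e : 37 ^ (1 + 1) = 1369 := by norm_num
    rw [e] at hb
    omega
  · have hb := aut_prime_pow_order_bound hV A h01 hsymm hdiag hk hsrg (σ ^ (orderOf σ / 41 ^ 2)) (hAk _)
      (by norm_num : Nat.Prime 41) 1 (by simpa using h1) (by simpa using hne 41 (by norm_num) (by norm_num))
    have e : 41 ^ (1 + 1) = 1681 := by norm_num
    rw [e] at hb
    omega
  · have hb := aut_prime_pow_order_bound hV A h01 hsymm hdiag hk hsrg (σ ^ (orderOf σ / 83 ^ 2)) (hAk _)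
      (by norm_num : Nat.Prime 83) 1 (by simpa using h1) (by simpa using hne 83 (by norm_num) (by norm_num))
    have e : 83 ^ (1 + 1) = 6889 := by norm_num
    rw [e] at hb
    omega

/-- **`83 ∣ orderOf σ ⇒ orderOf σ ∈ {83, 166}`.** -/
theorem aut_orderOf_of_83_dvd (hV : Fintype.card V = 333) (A : Matrix V V ℤ)
    (h01 : ∀ x y, A x y = 0 ∨ A x y = 1) (hsymm : ∀ x y, A y x = A x y) (hdiag : ∀ x, A x x = 0)
    (hk : ∀ x, ∑ y, A x y = 166) (hsrg : ∀ x y, ∑ z, A x z * A z y = 83 * (1 + (if x = y then 1 else 0)) - A x y)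
    (σ : Equiv.Perm V) (hA : ∀ x y, A (σ x) (σ y) = A x y) (h83 : 83 ∣ orderOf σ) :
    orderOf σ = 83 ∨ orderOf σ = 166 := by
  have hnot29 := fun m hm => aut_orderOf_not_dvd hV A h01 hsymm hdiag hk hsrg σ hA (m := m) hm
  have hnot30b := fun m hm => aut_orderOf_not_dvd_g30b hV A h01 hsymm hdiag hk hsrg σ hA (m := m) hm
  have hdvd : orderOf σ ∣ 166 := by
    rw [Nat.dvd_iff_prime_pow_dvd_dvd]
    intro p k hp hpk
    rcases Nat.eq_zero_or_pos k with rfl | hkpos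
    · simp
    have hpd : p ∣ orderOf σ := (dvd_pow_self p hkpos.ne').trans hpk
    rcases prime_dvd_orderOf_g30' hV A h01 hsymm hdiag hk hsrg σ hA hp hpd with rfl | rfl | rfl | rfl | rfl | rfl | rfl | rfl
    · have hkb : k ≤ 1 := by
        by_contra hlt
        have h2 : 2 ^ 2 ∣ orderOf σ := (pow_dvd_pow 2 (by omega : 2 ≤ k)).trans hpk
        have h3 : 332 ∣ orderOf σ := by
          simpa using Nat.Coprime.mul_dvd_of_dvd_of_dvd (by norm_num) h2 h83
        exact hnot30b 332 (by simp) h3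
      exact (pow_dvd_pow 2 hkb).trans (by norm_num)
    · have h3 : 249 ∣ orderOf σ := by
        simpa using Nat.Coprime.mul_dvd_of_dvd_of_dvd (by norm_num) hpd h83
      exact absurd h3 (hnot29 249 (by simp))
    · have h3 : 415 ∣ orderOf σ := by
        simpa using Nat.Coprime.mul_dvd_of_dvd_of_dvd (by norm_num) hpd h83
      exact absurd h3 (hnot30b 415 (by simp))
    · have h3 : 581 ∣ orderOf σ := by
        simpa using Nat.Coprime.mul_dvd_of_dvd_of_dvd (by norm_num) hpd h83
      exact absurd h3 (hnot30b 581 (by simp))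
    · have h3 : 913 ∣ orderOf σ := by
        simpa using Nat.Coprime.mul_dvd_of_dvd_of_dvd (by norm_num) hpd h83
      exact absurd h3 (hnot30b 913 (by simp))
    · have h3 : 3071 ∣ orderOf σ := by
        simpa using Nat.Coprime.mul_dvd_of_dvd_of_dvd (by norm_num) hpd h83
      exact absurd h3 (hnot30b 3071 (by simp))
    · have h3 : 3403 ∣ orderOf σ := by
        simpa using Nat.Coprime.mul_dvd_of_dvd_of_dvd (by norm_num) hpd h83
      exact absurd h3 (hnot30b 3403 (by simp))
    · have hk1 : k ≤ 1 := by
        by_contra hlt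
        have h2 : 83 ^ 2 ∣ orderOf σ := (pow_dvd_pow 83 (by omega : 2 ≤ k)).trans hpk
        exact sq_not_dvd_orderOf' hV A h01 hsymm hdiag hk hsrg σ hA (p := 83) (by norm_num) h2
      exact (pow_dvd_pow 83 hk1).trans (by norm_num)
  have hmem : orderOf σ ∈ Nat.divisors 166 := Nat.mem_divisors.mpr ⟨hdvd, by norm_num⟩
  rw [show Nat.divisors 166 = {1, 2, 83, 166} by decide] at hmem
  simp only [Finset.mem_insert, Finset.mem_singleton] at hmem
  rcases hmem with h | h | h | h <;> rw [h] at h83 ⊢ <;> omega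

/-- **`41 ∣ orderOf σ ⇒ orderOf σ ∈ {41, 82}`.** -/
theorem aut_orderOf_of_41_dvd (hV : Fintype.card V = 333) (A : Matrix V V ℤ)
    (h01 : ∀ x y, A x y = 0 ∨ A x y = 1) (hsymm : ∀ x y, A y x = A x y) (hdiag : ∀ x, A x x = 0)
    (hk : ∀ x, ∑ y, A x y = 166) (hsrg : ∀ x y, ∑ z, A x z * A z y = 83 * (1 + (if x = y then 1 else 0)) - A x y)
    (σ : Equiv.Perm V) (hA : ∀ x y, A (σ x) (σ y) = A x y) (h41 : 41 ∣ orderOf σ) :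
    orderOf σ = 41 ∨ orderOf σ = 82 := by
  have hnot29 := fun m hm => aut_orderOf_not_dvd hV A h01 hsymm hdiag hk hsrg σ hA (m := m) hm
  have hnot30b := fun m hm => aut_orderOf_not_dvd_g30b hV A h01 hsymm hdiag hk hsrg σ hA (m := m) hm
  have hdvd : orderOf σ ∣ 82 := by
    rw [Nat.dvd_iff_prime_pow_dvd_dvd]
    intro p k hp hpk
    rcases Nat.eq_zero_or_pos k with rfl | hkpos
    · simp
    have hpd : p ∣ orderOf σ := (dvd_pow_self p hkpos.ne').trans hpk
    rcases prime_dvd_orderOf_g30' hV A h01 hsymm hdiag hk hsrg σ hA hp hpd with rfl | rfl | rfl | rfl | rfl | rfl | rfl | rfl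
    · have hkb : k ≤ 1 := by
        by_contra hlt
        have h2 : 2 ^ 2 ∣ orderOf σ := (pow_dvd_pow 2 (by omega : 2 ≤ k)).trans hpk
        have h3 : 164 ∣ orderOf σ := by
          simpa using Nat.Coprime.mul_dvd_of_dvd_of_dvd (by norm_num) h2 h41
        exact hnot29 164 (by simp) h3
      exact (pow_dvd_pow 2 hkb).trans (by norm_num)
    · have h3 : 123 ∣ orderOf σ := by
        simpa using Nat.Coprime.mul_dvd_of_dvd_of_dvd (by norm_num) hpd h41
      exact absurd h3 (hnot29 123 (by simp))
    · have h3 : 205 ∣ orderOf σ := by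
        simpa using Nat.Coprime.mul_dvd_of_dvd_of_dvd (by norm_num) hpd h41
      exact absurd h3 (hnot30b 205 (by simp))
    · have h3 : 287 ∣ orderOf σ := by
        simpa using Nat.Coprime.mul_dvd_of_dvd_of_dvd (by norm_num) hpd h41
      exact absurd h3 (hnot30b 287 (by simp))
    · have h3 : 451 ∣ orderOf σ := by
        simpa using Nat.Coprime.mul_dvd_of_dvd_of_dvd (by norm_num) hpd h41
      exact absurd h3 (hnot30b 451 (by simp))
    · have h3 : 1517 ∣ orderOf σ := by
        simpa using Nat.Coprime.mul_dvd_of_dvd_of_dvd (by norm_num) hpd h41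
      exact absurd h3 (hnot30b 1517 (by simp))
    · have hk1 : k ≤ 1 := by
        by_contra hlt
        have h2 : 41 ^ 2 ∣ orderOf σ := (pow_dvd_pow 41 (by omega : 2 ≤ k)).trans hpk
        exact sq_not_dvd_orderOf' hV A h01 hsymm hdiag hk hsrg σ hA (p := 41) (by norm_num) h2
      exact (pow_dvd_pow 41 hk1).trans (by norm_num)
    · have h3 : 3403 ∣ orderOf σ := by
        simpa using Nat.Coprime.mul_dvd_of_dvd_of_dvd (by norm_num) hpd h41
      exact absurd h3 (hnot30b 3403 (by simp))
  have hmem : orderOf σ ∈ Nat.divisors 82 := Nat.mem_divisors.mpr ⟨hdvd, by norm_num⟩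
  rw [show Nat.divisors 82 = {1, 2, 41, 82} by decide] at hmem
  simp only [Finset.mem_insert, Finset.mem_singleton] at hmem
  rcases hmem with h | h | h | h <;> rw [h] at h41 ⊢ <;> omega

/-- **`37 ∣ orderOf σ ⇒ orderOf σ ∈ {37, 74, 148}`.** -/
theorem aut_orderOf_of_37_dvd (hV : Fintype.card V = 333) (A : Matrix V V ℤ)
    (h01 : ∀ x y, A x y = 0 ∨ A x y = 1) (hsymm : ∀ x y, A y x = A x y) (hdiag : ∀ x, A x x = 0)
    (hk : ∀ x, ∑ y, A x y = 166) (hsrg : ∀ x y, ∑ z, A x z * A z y = 83 * (1 + (if x = y then 1 else 0)) - A x y)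
    (σ : Equiv.Perm V) (hA : ∀ x y, A (σ x) (σ y) = A x y) (h37 : 37 ∣ orderOf σ) :
    orderOf σ = 37 ∨ orderOf σ = 74 ∨ orderOf σ = 148 := by
  have hnot29 := fun m hm => aut_orderOf_not_dvd hV A h01 hsymm hdiag hk hsrg σ hA (m := m) hm
  have hnot30b := fun m hm => aut_orderOf_not_dvd_g30b hV A h01 hsymm hdiag hk hsrg σ hA (m := m) hm
  have hdvd : orderOf σ ∣ 148 := by
    rw [Nat.dvd_iff_prime_pow_dvd_dvd]
    intro p k hp hpk
    rcases Nat.eq_zero_or_pos k with rfl | hkpos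
    · simp
    have hpd : p ∣ orderOf σ := (dvd_pow_self p hkpos.ne').trans hpk
    rcases prime_dvd_orderOf_g30' hV A h01 hsymm hdiag hk hsrg σ hA hp hpd with rfl | rfl | rfl | rfl | rfl | rfl | rfl | rfl
    · have hkb : k ≤ 2 := by
        by_contra hlt
        have h2 : 2 ^ 3 ∣ orderOf σ := (pow_dvd_pow 2 (by omega : 3 ≤ k)).trans hpk
        have h3 : 296 ∣ orderOf σ := by
          simpa using Nat.Coprime.mul_dvd_of_dvd_of_dvd (by norm_num) h2 h37
        exact hnot30b 296 (by simp) h3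
      exact (pow_dvd_pow 2 hkb).trans (by norm_num)
    · have h3 : 111 ∣ orderOf σ := by
        simpa using Nat.Coprime.mul_dvd_of_dvd_of_dvd (by norm_num) hpd h37
      exact absurd h3 (hnot29 111 (by simp))
    · have h3 : 185 ∣ orderOf σ := by
        simpa using Nat.Coprime.mul_dvd_of_dvd_of_dvd (by norm_num) hpd h37
      exact absurd h3 (hnot29 185 (by simp))
    · have h3 : 259 ∣ orderOf σ := by
        simpa using Nat.Coprime.mul_dvd_of_dvd_of_dvd (by norm_num) hpd h37
      exact absurd h3 (hnot30b 259 (by simp))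
    · have h3 : 407 ∣ orderOf σ := by
        simpa using Nat.Coprime.mul_dvd_of_dvd_of_dvd (by norm_num) hpd h37
      exact absurd h3 (hnot30b 407 (by simp))
    · have hk1 : k ≤ 1 := by
        by_contra hlt
        have h2 : 37 ^ 2 ∣ orderOf σ := (pow_dvd_pow 37 (by omega : 2 ≤ k)).trans hpk
        exact sq_not_dvd_orderOf' hV A h01 hsymm hdiag hk hsrg σ hA (p := 37) (by norm_num) h2
      exact (pow_dvd_pow 37 hk1).trans (by norm_num)
    · have h3 : 1517 ∣ orderOf σ := by
        simpa using Nat.Coprime.mul_dvd_of_dvd_of_dvd (by norm_num) hpd h37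
      exact absurd h3 (hnot30b 1517 (by simp))
    · have h3 : 3071 ∣ orderOf σ := by
        simpa using Nat.Coprime.mul_dvd_of_dvd_of_dvd (by norm_num) hpd h37
      exact absurd h3 (hnot30b 3071 (by simp))
  have hmem : orderOf σ ∈ Nat.divisors 148 := Nat.mem_divisors.mpr ⟨hdvd, by norm_num⟩
  rw [show Nat.divisors 148 = {1, 2, 4, 37, 74, 148} by decide] at hmem
  simp only [Finset.mem_insert, Finset.mem_singleton] at hmem
  rcases hmem with h | h | h | h | h | h <;> rw [h] at h37 ⊢ <;> omega

end largeprimes2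

end Summit.Ventures.DiscreteObjects.Hadamard
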